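/-
Copyright (c) 2026 the pub-hodgecm-mathlib formalisation cell (harness21).  Prover seat hodgecm-mathlib-LH4-p16 (g3), req620 Track A «(D-RAM) FOUR-FRAME» squad
((β₂) road (R-36), the K6 road — A6-ODD: the ODD row's CORE window identity ‹CORE-ODD.letter.v1› eff69f00 from the K6 spine and its per-cell payers), 2026-09-05.
-/
import Summits.HodgeConjecture.HodgeConjecture.Theorems.F0P3cDyRamCoreWindowInsideTop         -- ★ (P1) p864735 (LH4-p11): `coreWindow_of_insideWindow_and_topCell`
import Summits.HodgeConjecture.HodgeConjecture.Theorems.F0P3cDyRamInsideWindowIdentity       -- ★ A4 p864797 (LH4-p11): `insideWindow_identity`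
import Summits.HodgeConjecture.HodgeConjecture.Theorems.F0P3cDyRamInsideCellsDensityOdd      -- ★ A3-ODD p864894 (LH4-p18): `exists_density_insideCells_odd`
import Summits.HodgeConjecture.HodgeConjecture.Theorems.F0P3cDyRamInsideCellsLawFineOdd      -- ★ A2-ODD p864918 (LH4-p11 (g11)): `insideCells_law_fine_odd`
import Summits.HodgeConjecture.HodgeConjecture.Theorems.F0P3cDyRamRowInsideChartLetters      -- ★ A1 p864708 (this seat): `exists_rowInsideChart_letters`
import Summits.HodgeConjecture.HodgeConjecture.Theorems.F0P3cDyRamTopCellIdentityOfRow        -- ★ (2a) p865192 (LH4-p18 (g5)): `topCell_identity_of_row` = ★ A1-top p865011 + ★ A5-SIZES p865144 + ★ A5 p865015 `topCell_identity` (W ≥ 1)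
import Summits.HodgeConjecture.HodgeConjecture.Theorems.F0P3cDyRamDiagCellGapZeroIdentityOfRow -- ★ (2b) (LH4-p11 (g12)): `diagCell_gapZero_identity_of_row` = ★ (δ) p865093 + ★ (γ-2) p865211 (over ★ (α) p865150) + ★ A5-SIZES + ★ (γ) p865076 (W = 0)
import Summits.HodgeConjecture.HodgeConjecture.Theorems.F0P3cDyRamRowCleanCellBit            -- ★ p863209 (LH4-p06): `line_entry_mul_map_eq_one`, `depth_mod_two_eq`, `antiDepth_mod_two_eq`
import Summits.HodgeConjecture.HodgeConjecture.Theorems.F0P3cDyRamAxisColumnZeroOfFrame      -- ★ p862391: `formCongr_one_antidiagonal_three_eq_endoShape_two`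
import Summits.HodgeConjecture.HodgeConjecture.Theorems.F0P3cDyRamBeta2ConesRowSizes         -- ★ `two_le_d`
import Summits.HodgeConjecture.HodgeConjecture.Theorems.F0P3cDyRamBeta2ConesBOfRows         -- ★ p862801: brings every token of the cells currency
import Summits.HodgeConjecture.HodgeConjecture.Theorems.F0P3cDyRamCoreHolds                 -- ★ A6 (this seat): §0 `exists_fixedDigits` BY NAME (the even twin `core_holds` lives there)
import HarnessLib

/-!
# Crux `H413`, line LH4 «(D-RAM) FOUR-FRAME» — the (β₂) road (R-36), K6 road, A6-ODD: «‹CORE-ODD› HOLDS» — THE TWO-LITERAL WINDOWED CELL IDENTITY OF THE ODD ROW `2b + 1 = m`,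
# ASSEMBLED FROM THE K6 SPINE AND ITS PER-CELL PAYERS, UNDER THE K6 FLOOR `4·d ≤ N ∧ tE + 1 ≤ N`

Cell `hodgecm-mathlib` (D-0151), FLOOR 0, crux item H413 = `stmt-HodgeConjecture-24833`, route of record `HCCMUnconditional`; squad F0∕P3c∕LH4; lane
`--supports stmt-HodgeConjecture-24833 --as helper` (count-neutral; pays NO tier-0 row).  THEOREMS ONLY (no `def`, no instance, no notation, no `sorry`, default heartbeats);
★-only imports; (β₂) stays a HYPOTHESIS upstream.
THE STATEMENT.  `coreOdd_holds (N) (hN : ∀ d tE q, 4·d ≤ N d tE q ∧ tE + 1 ≤ N d tE q) : ‹CORE-ODD.letter.v1›[N]` where ‹CORE-ODD.letter.v1› (LH4-p04 (g10), 2026-09-05, β₂ WORD #26,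
`F0/P3c/LH4/LH4-p04/g10/CORE-ODD.letter.v1.LH4p04g10.lean.txt`, sha16 eff69f00) = ‹CORE.letter.v1› dd6c93c2 with the single token `2 * b = m ↦ 2 * b + 1 = m` = the binder `hcoreo` of
★ `…RowOddOfCoreOdd.rowOdd_of_coreOdd` (two literals, ALL binders of ‹beta2ConesB.letter.v2›): for the live ODD row `2b + 1 = m` (odd `d ≥ 3` only, by ★ `depth_mod_two_eq`) of the line `(m, jl)` and its window `i ≤ W := (jl − m)∕2`, `Σ_{i ≤ W} X_H(b + 2i, b) = Σ_{i ≤ W, i < d} X_A(b + 2i, b)`, `X_t` the difference of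
the two shell-restricted labelled counts of literal `t` (H = the hyperbolic plane `((Φ₂).over E, 1)` in the identity frame with `γ₂`; A = the anisotropic plane `(diag dg, η)` in the frame
`P₁` with `γ₁`).  The K6 floor (desk WORD #11): every payer takes `(N) (hN)`, β₂'s tier-0 text being `∃ V ∈ 𝓝 1`; `4·d ≤ N ≤ m` gives `b ≥ 2d`, `tE + 1 ≤ N` gives `tE < m`.
THE PROOF — every step a ★ file BY NAME (K6 desk WORDS #14–#31; the road's architecture A: ONE inside chart per row, ONE fine digit system, per-cell laws refined to it):
* prelude: ★ `two_le_d` (`|2| < 1`, `2 ≤ d`); parity `m ≡ d ≡ jl (mod 2)` by ★ `line_entry_mul_map_eq_one` + ★ `depth_mod_two_eq` ∕ ★ `antiDepth_mod_two_eq`, so `m + 2W = jl`, `d` odd;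
* ★ (P1) p864735 `coreWindow_of_insideWindow_and_topCell` splits the window identity into the INSIDE identity `hin` (cells `i < W`) and the TOP cell `htop` (`i = W`);
* `hin`: `W = 0` is empty; `W ≥ 1`: ★ A1 p864708 `exists_rowInsideChart_letters` (the inside chart `|ξ₀| = exp 2(W−1)`), ONE fine digit system `Rd⋆` mod `|ϖ|^{b + 2(W−1)}` (§0 over
  ★ `exists_repr_fixedBall_card`), ★ A3-ODD p864894 `exists_density_insideCells_odd` (one density), ★ A2-ODD p864918 `insideCells_law_fine_odd` at the H-frame and at the A-frame (frame facts
  ★ `det_antidiagonal_two`, ★ `StdForm.over_map`∕`transpose_over`, ★ `formCongr_one_antidiagonal_three_eq_endoShape_two`; `Matrix.det_diagonal`, `Matrix.diagonal_map`∕`diagonal_transpose`),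
  then ★ A4 p864797 `insideWindow_identity`;
* `htop`, `W ≥ 1`: ★ (2a) p865192 `topCell_identity_of_row` (= ★ A1-top p865011 + ★ A5-SIZES p865144 + ★ A5 p865015 `topCell_identity` over ★ A2-TOP p864968 ∕ ★ F1b-top p864859 ∕
  ★ (g-top) p864688); `W = 0` (gap zero `jl = m`: the window is the lone DIAGONAL cell `(b, b)`, the δ = 0 corner ‹D0› at every `d`): ★ (2b) `diagCell_gapZero_identity_of_row`
  (= ★ (δ) p865093 gap-zero chart + ★ (γ-2) p865211 gap-zero laws over ★ (α) p865150 `rowDiag_cellDiff_mul_card_eq_gapZero` + ★ A5-SIZES at `N := 0` + ★ (γ) p865076).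
THIS FILE, ONE theorem: HEAD `coreOdd_holds` (§0 `exists_fixedDigits` is ★ `…CoreHolds`').  Consumer: β₂ sub-dealer LH4-p04's board (`rowOdd_of_coreOdd N hN₁ (wrOdd_holds N) (coreOdd_holds N hN)`
= LH4-p08's `rowOdd_holds_of_coreOdd`), thence ‹ROW-ODD› → `row₂_of_even_odd` → lane B of `stub_law_cleanSgn₂`.  The even-row twin is ★ `…CoreHolds.core_holds`.
HONEST LABEL.  Count-neutral helper lane; `coreOdd_holds` is a THEOREM about the census objects under the K6 floor, it closes no tier-0 row by itself; β₂ `stub_law_cleanSgn₂` remains UNPROVED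
until LH4-p04's chain lands; `HC_CM` is proved only modulo the 7 printed citations (2 remaining named inputs: hLiu418 = `stmt-HodgeConjecture-24832`, h413 = `stmt-HodgeConjecture-24833`)
until rung 0 closes.
## References
* [Kottwitz1986BaseChangeUnits] R. E. Kottwitz, *Base change for unit elements of Hecke algebras*, Compositio Math. 60 (1986): §1 pp. 240–241.
* [Rogawski1990] J. D. Rogawski, *Automorphic Representations of Unitary Groups in Three Variables*, Ann. of Math. Stud. 123 (1990): §4.9 Prop. 4.9.1 (b) p. 55.
* [Flicker1998UnitaryFL] Y. Z. Flicker, *Elementary proof of the fundamental lemma for a unitary group*, Canad. J. Math. 50 (1998): Prop. 7 p. 84 (the level tables by classes).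
* [Serre1979] J.-P. Serre, *Local Fields*, GTM 67 (1979): Ch. XIV §2–§3.
-/

set_option autoImplicit false

noncomputable section
namespace Summit.HodgeConjecture.HodgeConjecture.Cruxes.H413.F0P3cDyRamCoreOddHolds

open scoped Matrix MatrixGroups Classical Valued WithZero
open WithZero Finset
open Literature.NumberTheory.Automorphic Literature.NumberTheory.Automorphic.UnitaryThreeFourFrame Literature.NumberTheory.Automorphic.UnitaryLatticeTree
open Literature.NumberTheory.Automorphic.HermitianLattice Literature.NumberTheory.Automorphic.EllipticPlaneAsFieldLine Literature.NumberTheory.LocalFields.QuadraticOrder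
open Literature.NumberTheory.Rogawski1990
open Summit.HodgeConjecture.HodgeConjecture.Cruxes.H413.F0P3cDyRamToricCensusDefs Summit.HodgeConjecture.HodgeConjecture.Cruxes.H413.F0P3cDyRamFourFramePieces
open Summit.HodgeConjecture.HodgeConjecture.Cruxes.H413.F0P3cDyRamFourFrameCensusDefs Summit.HodgeConjecture.HodgeConjecture.Cruxes.H413.F0P3cDyRamStageOneBDefs
open Summit.HodgeConjecture.HodgeConjecture.Cruxes.H413.F0P3cDyRamAxisColumnZeroOfFrame Summit.HodgeConjecture.HodgeConjecture.Cruxes.H413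
open Summit.HodgeConjecture.HodgeConjecture.Cruxes.H413.F0P3cDyRamRowCleanCellBit (line_entry_mul_map_eq_one depth_mod_two_eq antiDepth_mod_two_eq)
open Summit.HodgeConjecture.HodgeConjecture.Cruxes.H413.F0P3cDyRamBeta2ConesRowSizes (two_le_d)
open Summit.HodgeConjecture.HodgeConjecture.Cruxes.H413.F0P3cDyRamCoreWindowInsideTop (coreWindow_of_insideWindow_and_topCell)
open Summit.HodgeConjecture.HodgeConjecture.Cruxes.H413.F0P3cDyRamInsideWindowIdentity (insideWindow_identity)
open Summit.HodgeConjecture.HodgeConjecture.Cruxes.H413.F0P3cDyRamInsideCellsDensityOdd (exists_density_insideCells_odd)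
open Summit.HodgeConjecture.HodgeConjecture.Cruxes.H413.F0P3cDyRamInsideCellsLawFineOdd (insideCells_law_fine_odd)
open Summit.HodgeConjecture.HodgeConjecture.Cruxes.H413.F0P3cDyRamRowInsideChartLetters (exists_rowInsideChart_letters)
open Summit.HodgeConjecture.HodgeConjecture.Cruxes.H413.F0P3cDyRamTopCellIdentityOfRow (topCell_identity_of_row)
open Summit.HodgeConjecture.HodgeConjecture.Cruxes.H413.F0P3cDyRamDiagCellGapZeroIdentityOfRow (diagCell_gapZero_identity_of_row)
open Summit.HodgeConjecture.HodgeConjecture.Cruxes.H413.F0P3cDyRamCoreHolds (exists_fixedDigits)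

/-- **A6-ODD — «‹CORE-ODD› HOLDS»**: ‹CORE-ODD.letter.v1› eff69f00 VERBATIM under the K6 floor `4·d ≤ N ∧ tE + 1 ≤ N` — the two-literal windowed cell identity of the live ODD row `2b + 1 = m`,
`Σ_{i ≤ (jl−m)∕2} X_H(b + 2i, b) = Σ_{i ≤ (jl−m)∕2, i < d} X_A(b + 2i, b)`, assembled from ★ (P1) (inside + top), ★ A1∕A2∕A3∕A4 (inside cells on one fine digit system),
★ (2a) (the top cell, `W ≥ 1`) and ★ (2b) (the gap-zero diagonal cell, `W = 0`). [cite: Kottwitz1986BaseChangeUnits, §1 pp. 240–241] [cite: Rogawski1990, §4.9 Prop. 4.9.1 (b) p. 55]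
[cite: Flicker1998UnitaryFL, Prop. 7 p. 84] -/
theorem coreOdd_holds (N : ℕ → ℕ → ℕ → ℕ) (hN : ∀ d tE q, 4 * d ≤ N d tE q ∧ tE + 1 ≤ N d tE q) :
      ∀ (E M : Type) [Field E] [Valued E ℤᵐ⁰] [CompleteSpace E] [IsDiscreteValuationRing 𝒪[E]] [Finite 𝓀[E]]
        [Field M] [Valued M ℤᵐ⁰] [CompleteSpace M] [IsDiscreteValuationRing 𝒪[M]] [Finite 𝓀[M]]
        (σ : E →+* E) (ϖ : E) (d tE : ℕ) (_hD : IsRamifiedQuadraticDatum σ ϖ d tE) (_hσσ : ∀ a, σ (σ a) = a) (_h2 : ¬ IsUnit (2 : 𝒪[E]))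
        (jE : E →+* M) (ρ Θ : M →+* M) (α lam : M)
        (_hρρ : ∀ z, ρ (ρ z) = z) (_hvρ : ∀ z, Valued.v (ρ z) = Valued.v z) (_hρj : ∀ a, ρ (jE a) = jE a)
        (_hjv : ∀ a, Valued.v (jE a) ≤ 1 ↔ Valued.v a ≤ 1) (_hjfix : ∀ z : M, ρ z = z ↔ ∃ a, jE a = z) (_hΘj : ∀ a, Θ (jE a) = jE (σ a))
        (_hΘΘ : ∀ z, Θ (Θ z) = z) (_hΘρ : ∀ z, Θ (ρ z) = ρ (Θ z)) (_hvΘ : ∀ z, Valued.v (Θ z) = Valued.v z)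
        (_hα : ρ α ≠ α) (_hα1 : Valued.v α ≤ 1) (_hint : ∀ z : M, Valued.v z ≤ 1 → Valued.v ((z - ρ z) / (α - ρ α)) ≤ 1)
        (_hΘlam : Θ lam * lam = 1) (_hvlam : Valued.v lam = 1) (_hbasis : ∀ z : M, ∃! pq : E × E, z = jE pq.1 + jE pq.2 * lam)
        (_hU : Valued.v (α - ρ α) = 1) (_hτ : Valued.v (α - Θ α) < 1)
        (_hσres : ∀ z : M, ρ z = z → Valued.v z ≤ 1 → Valued.v (Θ z - z) < 1) (_hres : ∀ z : M, Valued.v z ≤ 1 → Valued.v (z - Θ z) < 1)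
        (_hΘne : ∃ x : M, Θ x ≠ x) (_hDM : IsRamifiedQuadraticDatum Θ (jE ϖ) d tE) (_hjiso : ∀ a, Valued.v (jE a) = Valued.v a)
        (_hq : Nat.card 𝓀[M] = Nat.card 𝓀[E] ^ 2) (_hjpow : ∀ (t : E) (n : ℤ), Valued.v (jE t) = Valued.v (jE ϖ) ^ n ↔ Valued.v t = Valued.v ϖ ^ n)
        (_hEval : ∀ c : M, ρ c = c → c ≠ 0 → Valued.v c ≤ 1 → ∃ n : ℕ, Valued.v c = Valued.v (jE ϖ) ^ n)
        (_hϖmax : ∀ t : M, ρ t = t → Valued.v t < 1 → Valued.v t ≤ Valued.v (jE ϖ))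
        (γ₂ : GL (Fin 2) E) (u : GL (Fin 1) E)
        (_hdet : (γ₂ : Matrix (Fin 2) (Fin 2) E).det * σ (γ₂ : Matrix (Fin 2) (Fin 2) E).det = 1)
        (_htr : (γ₂ : Matrix (Fin 2) (Fin 2) E).trace = (γ₂ : Matrix (Fin 2) (Fin 2) E).det * σ (γ₂ : Matrix (Fin 2) (Fin 2) E).trace)
        (_hirr : ∀ x : E, x * x - (γ₂ : Matrix (Fin 2) (Fin 2) E).trace * x + (γ₂ : Matrix (Fin 2) (Fin 2) E).det ≠ 0)
        (_hlam2 : lam * lam = jE (γ₂ : Matrix (Fin 2) (Fin 2) E).trace * lam - jE (γ₂ : Matrix (Fin 2) (Fin 2) E).det)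
        (_hρlam : ρ lam = jE (γ₂ : Matrix (Fin 2) (Fin 2) E).trace - lam) (m jl : ℕ) (_hm : Valued.v (lam - jE ((u : Matrix (Fin 1) (Fin 1) E) 0 0)) = WithZero.exp (-(m : ℤ)))
        (_hjl : Valued.v ((lam - jE ((u : Matrix (Fin 1) (Fin 1) E) 0 0)) - ρ (lam - jE ((u : Matrix (Fin 1) (Fin 1) E) 0 0))) = WithZero.exp (-(jl : ℤ)))
        (_hs : Valued.v ((γ₂ : Matrix (Fin 2) (Fin 2) E).trace - 2) * Valued.v (ϖ ^ (d % 2)) ≤ Valued.v (ϖ ^ mcOfRecord d))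
        (_hp : Valued.v ((γ₂ : Matrix (Fin 2) (Fin 2) E).det - (γ₂ : Matrix (Fin 2) (Fin 2) E).trace + 1) ≤ Valued.v (ϖ ^ mcOfRecord d))
        (_hNm : N d tE (Nat.card 𝓀[E]) ≤ m) (_hu1N : Valued.v (((u : Matrix (Fin 1) (Fin 1) E) 0 0) - 1) ≤ Valued.v (ϖ ^ N d tE (Nat.card 𝓀[E]))) (_hlam1 : Valued.v (lam - 1) ≤ Valued.v (jE ϖ ^ N d tE (Nat.card 𝓀[E])))
        (_hu : Valued.v ((u : Matrix (Fin 1) (Fin 1) E) 0 0) = 1) (_hum : Valued.v (((u : Matrix (Fin 1) (Fin 1) E) 0 0) - 1) ≤ Valued.v (ϖ ^ mstarOfRecord d))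
        (_hg1 : ∀ i j, Valued.v ((γ₂ : Matrix (Fin 2) (Fin 2) E) i j - (1 : Matrix (Fin 2) (Fin 2) E) i j) ≤ Valued.v (ϖ ^ N d tE (Nat.card 𝓀[E]))) (P₁ : GL (Fin 3) E) (dg : Fin 2 → E) (η : E) (γ₁ : GL (Fin 2) E)
        (_hΓ : endoGL (γ₂, u) ∈ unitaryGroupOfForm σ ((StdForm.antidiagonal 3).over E))
        (_hΓ' : P₁ * endoGL (γ₁, u) * P₁⁻¹ ∈ unitaryGroupOfForm σ ((StdForm.antidiagonal 3).over E))
        (_hA : formCongr σ P₁ ((StdForm.antidiagonal 3).over E) = (!![(Matrix.diagonal dg) 0 0, 0, (Matrix.diagonal dg) 0 1; 0, η, 0; (Matrix.diagonal dg) 1 0, 0, (Matrix.diagonal dg) 1 1] : Matrix (Fin 3) (Fin 3) E))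
        (_hdg1 : ∀ i, Valued.v (dg i) = 1) (_hdgσ : ∀ i, σ (dg i) = dg i) (_hησ : σ η = η) (_hη1 : Valued.v η = 1) (_hηN : ¬ ∃ t : E, t * σ t = η)
        (_hγ₁ : γ₁ ∈ unitaryGroupOfForm σ (Matrix.diagonal dg)) (_hA12 : (γ₁ : Matrix (Fin 2) (Fin 2) E).charpoly = (γ₂ : Matrix (Fin 2) (Fin 2) E).charpoly)
        (φ : (Fin 2 → E) →+ M) (h : M) (φ' : (Fin 2 → E) →+ M) (h' : M) (_hφs : ∀ (c : E) (x : Fin 2 → E), φ (c • x) = jE c * φ x) (_hφi : Function.Injective φ) (_hφo : Function.Surjective φ)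
        (_hφγ : ∀ x, φ ((γ₂ : Matrix (Fin 2) (Fin 2) E).mulVec x) = lam * φ x)
        (_hform : ∀ x y, jE (pairing σ ((StdForm.antidiagonal 2).over E) x y) = h * Θ (φ x) * φ y + ρ (h * Θ (φ x) * φ y)) (_hΘh : Θ h = h) (_hh : h ≠ 0)
        (_hhyper : ∃ x : M, x ≠ 0 ∧ h * Θ x * x + ρ (h * Θ x * x) = 0)
        (_hφ's : ∀ (c : E) (x : Fin 2 → E), φ' (c • x) = jE c * φ' x) (_hφ'i : Function.Injective φ') (_hφ'o : Function.Surjective φ')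
        (_hφ'γ : ∀ x, φ' ((γ₁ : Matrix (Fin 2) (Fin 2) E).mulVec x) = lam * φ' x)
        (_hform' : ∀ x y, jE (pairing σ (Matrix.diagonal dg) x y) = h' * Θ (φ' x) * φ' y + ρ (h' * Θ (φ' x) * φ' y)) (_hΘh' : Θ h' = h') (_hh' : h' ≠ 0)
        (J R R' : ℕ) (f f' : ℕ → ℕ → AddSubgroup M → ℕ)
        (_hfinF : {L₃ : Submodule 𝒪[E] (Fin 3 → E) | IsSelfDualLattice σ ϖ (!![((StdForm.antidiagonal 2).over E) 0 0, 0, ((StdForm.antidiagonal 2).over E) 0 1; 0, (1 : E), 0; ((StdForm.antidiagonal 2).over E) 1 0, 0, ((StdForm.antidiagonal 2).over E) 1 1] : Matrix (Fin 3) (Fin 3) E) L₃ ∧ mapGL (endoGL (γ₂, u)) L₃ = L₃}.Finite)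
        (_hR : ∀ L₃ : Submodule 𝒪[E] (Fin 3 → E), IsSelfDualLattice σ ϖ (!![((StdForm.antidiagonal 2).over E) 0 0, 0, ((StdForm.antidiagonal 2).over E) 0 1; 0, (1 : E), 0; ((StdForm.antidiagonal 2).over E) 1 0, 0, ((StdForm.antidiagonal 2).over E) 1 1] : Matrix (Fin 3) (Fin 3) E) L₃ →
          mapGL (endoGL (γ₂, u)) L₃ = L₃ → ∀ b : ℕ, (∀ c : E, (Pi.single 1 c : Fin 3 → E) ∈ L₃ ↔ Valued.v c ≤ Valued.v ϖ ^ b) → b ≤ R)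
        (_hfinF' : {L₃ : Submodule 𝒪[E] (Fin 3 → E) | IsSelfDualLattice σ ϖ (!![(Matrix.diagonal dg) 0 0, 0, (Matrix.diagonal dg) 0 1; 0, η, 0; (Matrix.diagonal dg) 1 0, 0, (Matrix.diagonal dg) 1 1] : Matrix (Fin 3) (Fin 3) E) L₃ ∧ mapGL (endoGL (γ₁, u)) L₃ = L₃}.Finite)
        (_hR' : ∀ L₃ : Submodule 𝒪[E] (Fin 3 → E), IsSelfDualLattice σ ϖ (!![(Matrix.diagonal dg) 0 0, 0, (Matrix.diagonal dg) 0 1; 0, η, 0; (Matrix.diagonal dg) 1 0, 0, (Matrix.diagonal dg) 1 1] : Matrix (Fin 3) (Fin 3) E) L₃ →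
          mapGL (endoGL (γ₁, u)) L₃ = L₃ → ∀ b : ℕ, (∀ c : E, (Pi.single 1 c : Fin 3 → E) ∈ L₃ ↔ Valued.v c ≤ Valued.v ϖ ^ b) → b ≤ R')
        (_hJ : ¬ IsOrd ρ α (jE ϖ ^ (J + 1)) lam) (_hfinLS : ∀ j a, (levelSet ρ Θ α (jE ϖ) h j a).Finite) (_hfinLS' : ∀ j a, (levelSet ρ Θ α (jE ϖ) h' j a).Finite)
        (_hf : ∀ (b j : ℕ) (Λ : AddSubgroup M) (x₀ : M) (r : E), 1 ≤ b → x₀ ≠ 0 → (∀ x, x ∈ Λ ↔ ∃ z, IsOrd ρ α (jE ϖ ^ j) z ∧ x = x₀ * z) →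
          IsOrd ρ α (jE ϖ ^ j) (dualGen ρ Θ α (jE ϖ ^ j) h x₀) → ¬ IsOrd ρ α (jE ϖ ^ j) (dualGen ρ Θ α (jE ϖ ^ j) h x₀ / jE ϖ) → Valued.v (dualGen ρ Θ α (jE ϖ ^ j) h x₀) = Valued.v (jE ϖ) ^ b →
          (∀ b', (∀ x ∈ Λ, Valued.v (h * Θ x * b' + ρ (h * Θ x * b')) ≤ 1) → (lam - jE ((u : Matrix (Fin 1) (Fin 1) E) 0 0)) * b' ∈ Λ) → IsOrd ρ α (jE ϖ ^ j) lam →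
          jE r = glueUnit ρ Θ α (jE ϖ ^ j) h (jE ϖ) (jE 1) x₀ b →
          f b j Λ = Nat.card {x : 𝒪[E] ⧸ 𝓂[E] ^ (2 * b) // ∃ u' : 𝒪[E], Ideal.Quotient.mk (𝓂[E] ^ (2 * b)) u' = x ∧ Valued.v ((u' : E) * σ u' - r) ≤ Valued.v (ϖ ^ (2 * b))})
        (_hf' : ∀ (b j : ℕ) (Λ : AddSubgroup M) (x₀ : M) (r : E), 1 ≤ b → x₀ ≠ 0 → (∀ x, x ∈ Λ ↔ ∃ z, IsOrd ρ α (jE ϖ ^ j) z ∧ x = x₀ * z) →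
          IsOrd ρ α (jE ϖ ^ j) (dualGen ρ Θ α (jE ϖ ^ j) h' x₀) → ¬ IsOrd ρ α (jE ϖ ^ j) (dualGen ρ Θ α (jE ϖ ^ j) h' x₀ / jE ϖ) → Valued.v (dualGen ρ Θ α (jE ϖ ^ j) h' x₀) = Valued.v (jE ϖ) ^ b →
          (∀ b', (∀ x ∈ Λ, Valued.v (h' * Θ x * b' + ρ (h' * Θ x * b')) ≤ 1) → (lam - jE ((u : Matrix (Fin 1) (Fin 1) E) 0 0)) * b' ∈ Λ) → IsOrd ρ α (jE ϖ ^ j) lam →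
          jE r = glueUnit ρ Θ α (jE ϖ ^ j) h' (jE ϖ) (jE η) x₀ b →
          f' b j Λ = Nat.card {x : 𝒪[E] ⧸ 𝓂[E] ^ (2 * b) // ∃ u' : 𝒪[E], Ideal.Quotient.mk (𝓂[E] ^ (2 * b)) u' = x ∧ Valued.v ((u' : E) * σ u' - r) ≤ Valued.v (ϖ ^ (2 * b))}),
        ∀ b : ℕ, 1 ≤ b → 2 * b + 1 = m → (¬ ∃ x : M, x ≠ 0 ∧ h' * Θ x * x + ρ (h' * Θ x * x) = 0) →
          ∑ i ∈ Finset.range ((jl - m) / 2 + 1),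
            (((∑ᶠ Λ ∈ levelSetDep ρ Θ α (jE ϖ) h (b + 2 * i) b (lam - jE ((u : Matrix (Fin 1) (Fin 1) E) 0 0)) ∩
                      {Λ | ∃ B : Submodule 𝒪[E] (Fin 2 → E), B.toAddSubgroup.map φ = Λ ∧
                        ∃ L₃ : Submodule 𝒪[E] (Fin 3 → E), IsSelfDualLattice σ ϖ (!![((StdForm.antidiagonal 2).over E) 0 0, 0, ((StdForm.antidiagonal 2).over E) 0 1; 0, (1 : E), 0; ((StdForm.antidiagonal 2).over E) 1 0, 0, ((StdForm.antidiagonal 2).over E) 1 1] : Matrix (Fin 3) (Fin 3) E) L₃ ∧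
                          L₃ ⊓ LinearMap.ker ((LinearMap.proj (1 : Fin 3) : (Fin 3 → E) →ₗ[E] E).restrictScalars 𝒪[E]) =
                            B.map ((Matrix.toLin' (!![1, 0; 0, 0; 0, 1] : Matrix (Fin 3) (Fin 2) E)).restrictScalars 𝒪[E]) ∧
                          (∀ c : E, (Pi.single 1 c : Fin 3 → E) ∈ L₃ ↔ Valued.v c ≤ Valued.v ϖ ^ b) ∧
                          (LatticeNearTransvShell ϖ (d % 2) (mstarOfRecord d) ((((endoGL (γ₂, u) : GL (Fin 3) E) : Matrix (Fin 3) (Fin 3) E) - 1)) L₃ ∧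
                            {z : E | ∃ y ∈ L₃, Valued.v ((ϖ ^ (mstarOfRecord d))⁻¹ * (z - pairing σ (!![((StdForm.antidiagonal 2).over E) 0 0, 0, ((StdForm.antidiagonal 2).over E) 0 1; 0, (1 : E), 0; ((StdForm.antidiagonal 2).over E) 1 0, 0, ((StdForm.antidiagonal 2).over E) 1 1] : Matrix (Fin 3) (Fin 3) E) y (((((endoGL (γ₂, u) : GL (Fin 3) E) : Matrix (Fin 3) (Fin 3) E) - 1)) *ᵥ y))) ≤ 1} =
                              valueSetMod σ ϖ (mstarOfRecord d) (xPlus σ ϖ d))}, f b (b + 2 * i) Λ : ℕ) : ℤ) -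
                  ((∑ᶠ Λ ∈ levelSetDep ρ Θ α (jE ϖ) h (b + 2 * i) b (lam - jE ((u : Matrix (Fin 1) (Fin 1) E) 0 0)) ∩
                      {Λ | ∃ B : Submodule 𝒪[E] (Fin 2 → E), B.toAddSubgroup.map φ = Λ ∧
                        ∃ L₃ : Submodule 𝒪[E] (Fin 3 → E), IsSelfDualLattice σ ϖ (!![((StdForm.antidiagonal 2).over E) 0 0, 0, ((StdForm.antidiagonal 2).over E) 0 1; 0, (1 : E), 0; ((StdForm.antidiagonal 2).over E) 1 0, 0, ((StdForm.antidiagonal 2).over E) 1 1] : Matrix (Fin 3) (Fin 3) E) L₃ ∧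
                          L₃ ⊓ LinearMap.ker ((LinearMap.proj (1 : Fin 3) : (Fin 3 → E) →ₗ[E] E).restrictScalars 𝒪[E]) =
                            B.map ((Matrix.toLin' (!![1, 0; 0, 0; 0, 1] : Matrix (Fin 3) (Fin 2) E)).restrictScalars 𝒪[E]) ∧
                          (∀ c : E, (Pi.single 1 c : Fin 3 → E) ∈ L₃ ↔ Valued.v c ≤ Valued.v ϖ ^ b) ∧
                          (LatticeNearTransvShell ϖ (d % 2) (mcOfRecord d) ((((endoGL (γ₂, u) : GL (Fin 3) E) : Matrix (Fin 3) (Fin 3) E) - 1)) L₃ ∧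
                            ¬ {z : E | ∃ y ∈ L₃, Valued.v ((ϖ ^ (mstarOfRecord d))⁻¹ * (z - pairing σ (!![((StdForm.antidiagonal 2).over E) 0 0, 0, ((StdForm.antidiagonal 2).over E) 0 1; 0, (1 : E), 0; ((StdForm.antidiagonal 2).over E) 1 0, 0, ((StdForm.antidiagonal 2).over E) 1 1] : Matrix (Fin 3) (Fin 3) E) y (((((endoGL (γ₂, u) : GL (Fin 3) E) : Matrix (Fin 3) (Fin 3) E) - 1)) *ᵥ y))) ≤ 1} =
                              valueSetMod σ ϖ (mstarOfRecord d) (xPlus σ ϖ d))}, f b (b + 2 * i) Λ : ℕ) : ℤ)) =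
          ∑ i ∈ Finset.range (min ((jl - m) / 2 + 1) d),
            (((∑ᶠ Λ ∈ levelSetDep ρ Θ α (jE ϖ) h' (b + 2 * i) b (lam - jE ((u : Matrix (Fin 1) (Fin 1) E) 0 0)) ∩
                      {Λ | ∃ B : Submodule 𝒪[E] (Fin 2 → E), B.toAddSubgroup.map φ' = Λ ∧
                        ∃ L₃ : Submodule 𝒪[E] (Fin 3 → E), IsSelfDualLattice σ ϖ (!![(Matrix.diagonal dg) 0 0, 0, (Matrix.diagonal dg) 0 1; 0, η, 0; (Matrix.diagonal dg) 1 0, 0, (Matrix.diagonal dg) 1 1] : Matrix (Fin 3) (Fin 3) E) L₃ ∧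
                          L₃ ⊓ LinearMap.ker ((LinearMap.proj (1 : Fin 3) : (Fin 3 → E) →ₗ[E] E).restrictScalars 𝒪[E]) =
                            B.map ((Matrix.toLin' (!![1, 0; 0, 0; 0, 1] : Matrix (Fin 3) (Fin 2) E)).restrictScalars 𝒪[E]) ∧
                          (∀ c : E, (Pi.single 1 c : Fin 3 → E) ∈ L₃ ↔ Valued.v c ≤ Valued.v ϖ ^ b) ∧
                          (LatticeNearTransvShell ϖ (d % 2) (mstarOfRecord d) ((((endoGL (γ₁, u) : GL (Fin 3) E) : Matrix (Fin 3) (Fin 3) E) - 1)) L₃ ∧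
                            {z : E | ∃ y ∈ L₃, Valued.v ((ϖ ^ (mstarOfRecord d))⁻¹ * (z - pairing σ (!![(Matrix.diagonal dg) 0 0, 0, (Matrix.diagonal dg) 0 1; 0, η, 0; (Matrix.diagonal dg) 1 0, 0, (Matrix.diagonal dg) 1 1] : Matrix (Fin 3) (Fin 3) E) y (((((endoGL (γ₁, u) : GL (Fin 3) E) : Matrix (Fin 3) (Fin 3) E) - 1)) *ᵥ y))) ≤ 1} =
                              valueSetMod σ ϖ (mstarOfRecord d) (xPlus σ ϖ d))}, f' b (b + 2 * i) Λ : ℕ) : ℤ) -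
                  ((∑ᶠ Λ ∈ levelSetDep ρ Θ α (jE ϖ) h' (b + 2 * i) b (lam - jE ((u : Matrix (Fin 1) (Fin 1) E) 0 0)) ∩
                      {Λ | ∃ B : Submodule 𝒪[E] (Fin 2 → E), B.toAddSubgroup.map φ' = Λ ∧
                        ∃ L₃ : Submodule 𝒪[E] (Fin 3 → E), IsSelfDualLattice σ ϖ (!![(Matrix.diagonal dg) 0 0, 0, (Matrix.diagonal dg) 0 1; 0, η, 0; (Matrix.diagonal dg) 1 0, 0, (Matrix.diagonal dg) 1 1] : Matrix (Fin 3) (Fin 3) E) L₃ ∧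
                          L₃ ⊓ LinearMap.ker ((LinearMap.proj (1 : Fin 3) : (Fin 3 → E) →ₗ[E] E).restrictScalars 𝒪[E]) =
                            B.map ((Matrix.toLin' (!![1, 0; 0, 0; 0, 1] : Matrix (Fin 3) (Fin 2) E)).restrictScalars 𝒪[E]) ∧
                          (∀ c : E, (Pi.single 1 c : Fin 3 → E) ∈ L₃ ↔ Valued.v c ≤ Valued.v ϖ ^ b) ∧
                          (LatticeNearTransvShell ϖ (d % 2) (mcOfRecord d) ((((endoGL (γ₁, u) : GL (Fin 3) E) : Matrix (Fin 3) (Fin 3) E) - 1)) L₃ ∧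
                            ¬ {z : E | ∃ y ∈ L₃, Valued.v ((ϖ ^ (mstarOfRecord d))⁻¹ * (z - pairing σ (!![(Matrix.diagonal dg) 0 0, 0, (Matrix.diagonal dg) 0 1; 0, η, 0; (Matrix.diagonal dg) 1 0, 0, (Matrix.diagonal dg) 1 1] : Matrix (Fin 3) (Fin 3) E) y (((((endoGL (γ₁, u) : GL (Fin 3) E) : Matrix (Fin 3) (Fin 3) E) - 1)) *ᵥ y))) ≤ 1} =
                              valueSetMod σ ϖ (mstarOfRecord d) (xPlus σ ϖ d))}, f' b (b + 2 * i) Λ : ℕ) : ℤ)) := by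
  intro E M _ _ _ _ _ _ _ _ _ _ σ ϖ d tE hD hσσ h2 jE ρ Θ α lam hρρ hvρ hρj hjv hjfix hΘj hΘΘ hΘρ hvΘ hα hα1 hint hΘlam hvlam hbasis hU hτ hσres hres hΘne hDM hjiso hq hjpow hEval hϖmax γ₂ u hdet htr hirr hlam2 hρlam m jl hm hjl hs hp hNm hu1N hlam1 hu hum hg1 P₁ dg η γ₁ hΓ hΓ' hA hdg1 hdgσ hησ hη1 hηN hγ₁ hA12 φ h φ' h' hφs hφi hφo hφγ hform hΘh hh hhyper hφ's hφ'i hφ'o hφ'γ hform' hΘh' hh' J R R' f f' hfinF hR hfinF' hR' hJ hfinLS hfinLS' hf hf' b hb hbm han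
  obtain ⟨hσσ', hvσ, hϖ, hfix, hdiff, hd1, h2t⟩ := id hD
  obtain ⟨h2v, hd2⟩ := two_le_d hD h2
  have hfloor := hN d tE (Nat.card 𝓀[E])
  have htE : tE < m := by omega
  have hm4d : 4 * d ≤ m := by omega
  -- parity on the fence: `m ≡ d ≡ jl (mod 2)`
  have hΓ₁ : (1 : GL (Fin 3) E) * endoGL (γ₂, u) * 1⁻¹ ∈ unitaryGroupOfForm σ ((StdForm.antidiagonal 3).over E) := by rwa [one_mul, inv_one, mul_one]
  have huu := line_entry_mul_map_eq_one σ (one_ne_zero : (1 : E) ≠ 0) (formCongr_one_antidiagonal_three_eq_endoShape_two σ) hΓ₁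
  have hm2 : m % 2 = d % 2 := depth_mod_two_eq jE hΘj hDM hΘlam huu hm htE
  have hjl' : Valued.v (lam - ρ lam) = WithZero.exp (-(jl : ℤ)) := by
    rw [← show lam - jE ((u : Matrix (Fin 1) (Fin 1) E) 0 0) - ρ (lam - jE ((u : Matrix (Fin 1) (Fin 1) E) 0 0)) = lam - ρ lam by rw [map_sub ρ, hρj]; ring]; exact hjl
  have hmjl : m ≤ jl := by
    have h1 : Valued.v ((lam - jE ((u : Matrix (Fin 1) (Fin 1) E) 0 0)) - ρ (lam - jE ((u : Matrix (Fin 1) (Fin 1) E) 0 0))) ≤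
        Valued.v (lam - jE ((u : Matrix (Fin 1) (Fin 1) E) 0 0)) :=
      (Valuation.map_sub _ _ _).trans (max_le le_rfl (by rw [hvρ]))
    rw [hm, hjl] at h1
    have := WithZero.exp_le_exp.1 h1; omega
  have hj2 : jl % 2 = d % 2 := antiDepth_mod_two_eq jE hΘρ hDM hΘlam hvlam hvρ hjl' (by omega)
  have hd1 : d % 2 = 1 := by omega
  have hWjl : m + 2 * ((jl - m) / 2) = jl := by omega
  -- THE WINDOW = INSIDE + TOP (★ (P1))
  refine coreWindow_of_insideWindow_and_topCell ρ Θ α (jE ϖ) h h' _ f f' b _ _ _ _ ((jl - m) / 2) d ?_ ?_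
  · -- `hin`: the inside window identity (★ A4) — trivial when the window has no inside cell
    rcases Nat.eq_zero_or_pos ((jl - m) / 2) with hW0 | hWpos
    · rw [hW0]; simp
    -- the row's inside chart (★ A1) and the common fine digit system `Rd⋆` mod `|ϖ|^(b + 2(W−1))`
    obtain ⟨κ₀, ξ₀, μa, μb, R₀, γ₀, αc, γc, hκ₀, hΘκ₀, -, hκ₀v, hξ, hΘξ, hξ0, hξv, hξjl, hμab, hR₀, hγ₀, hâv, hbv, hα₁σ, hα₁1, hγ₁σ, hγ₁v, hγ₁1,
      haff⟩ := exists_rowInsideChart_letters hD jE hjiso hjfix hΘj hρρ hvρ hΘρ hα hα1 hint hU hDM hq hσres hτ lam ((u : Matrix (Fin 1) (Fin 1) E) 0 0) hm hjl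
        (b := b) (by omega) hWpos hWjl
    obtain ⟨Rd, hRd1', hRd2', hRd3'⟩ := exists_fixedDigits hσσ' hvσ hfix hϖ hdiff (b + 2 * ((jl - m) / 2 - 1))
    -- (A3-ODD) ONE density for the row and both literals (★ LH4-p18 `exists_density_insideCells_odd`)
    obtain ⟨φd, hdens⟩ := exists_density_insideCells_odd σ ϖ d tE hD hσσ h2 jE ρ Θ α lam hρρ hvρ hρj hjv hjfix hΘj hΘΘ hΘρ hvΘ hα hα1 hint hvlam hU hτ hσres
      hDM hjiso hq hjpow hϖmax γ₂ u m jl hm hjl P₁ dg η γ₁ hA hdgσ hησ hη1 hηN φ h φ' h' hφs hφi hφo hφγ hform hΘh hh hhyper hφ's hφ'i hφ'o hφ'γ hform'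
      hΘh' hh' han f f' hfinLS hfinLS' hf hf' b hb hbm ((jl - m) / 2) hWpos hWjl hκ₀ hΘκ₀ hκ₀v hξ hΘξ hξv Rd hRd1' hRd2' hRd3' (by omega) (by omega)
    -- (A2-ODD) the inside cells' laws on `Rd⋆` (★ LH4-p11 `insideCells_law_fine_odd`), literal 1: the hyperbolic block `((Φ₂).over E, 1)` in the identity frame
    have hH₂ : IsUnit ((StdForm.antidiagonal 2).over E).det := by rw [det_antidiagonal_two]; exact isUnit_one.neg
    have hH₂σ : ((((StdForm.antidiagonal 2).over E).map σ))ᵀ = (StdForm.antidiagonal 2).over E := by rw [StdForm.over_map, StdForm.transpose_over]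
    have hlawH := insideCells_law_fine_odd σ ϖ d tE hD jE ρ Θ α lam hρρ hvρ hjv hjfix hΘj hΘΘ hΘρ hvΘ hα hα1 hint hΘlam hvlam hU hτ hσres hDM hjiso hq hjpow hϖmax γ₂ u
      m jl hm hjl hum ((StdForm.antidiagonal 2).over E) 1 hH₂ hH₂σ (by rw [map_one]) (map_one σ) 1 (formCongr_one_antidiagonal_three_eq_endoShape_two σ) hΓ₁ φ h hφs
      hφi hφo hφγ hform hΘh hh f hfinLS hf hfloor.1 hNm hu1N hlam1 b hbm hd1 h2 hWjl hκ₀ hΘκ₀ hκ₀v hξ hΘξ hξjl hμab hR₀ hγ₀ hα₁σ hα₁1 hγ₁σ hγ₁v haff Rd le_rfl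
      hRd1' hRd2' hRd3'
    -- literal 2: the anisotropic block `(diag dg, η)` in the frame `P₁`
    have hH₂' : IsUnit (Matrix.diagonal dg).det := by
      rw [Matrix.det_diagonal]; refine isUnit_iff_ne_zero.2 (Finset.prod_ne_zero_iff.2 fun i _ h0 => ?_)
      have h1 := hdg1 i; rw [h0, map_zero] at h1; exact zero_ne_one h1
    have hH₂σ' : ((Matrix.diagonal dg).map σ)ᵀ = Matrix.diagonal dg := by
      rw [Matrix.diagonal_map (map_zero _), Matrix.diagonal_transpose]; exact congrArg Matrix.diagonal (funext hdgσ)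
    have hlawA := insideCells_law_fine_odd σ ϖ d tE hD jE ρ Θ α lam hρρ hvρ hjv hjfix hΘj hΘΘ hΘρ hvΘ hα hα1 hint hΘlam hvlam hU hτ hσres hDM hjiso hq hjpow hϖmax γ₁ u
      m jl hm hjl hum (Matrix.diagonal dg) η hH₂' hH₂σ' hη1 hησ P₁ hA hΓ' φ' h' hφ's hφ'i hφ'o hφ'γ hform' hΘh' hh' f' hfinLS' hf' hfloor.1 hNm hu1N hlam1 b hbm hd1
      h2 hWjl hκ₀ hΘκ₀ hκ₀v hξ hΘξ hξjl hμab hR₀ hγ₀ hα₁σ hα₁1 hγ₁σ hγ₁v haff Rd le_rfl hRd1' hRd2' hRd3'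
    exact insideWindow_identity hD h2v hd2 jE hjfix hΘj hjiso hρρ hvρ hΘρ hU P₁ dg η hA hηN hησ φ hform hΘh hh φ' hform' hΘh' hh' hκ₀ hΘκ₀ hκ₀v hξ hΘξ
      hWpos hξv _ f f' b _ _ _ _ hfinLS hfinLS' Rd hRd1' hRd2' hRd3' (by omega) hα₁σ hα₁1 hγ₁σ (by simpa using hγ₁v) hlawH hlawA φd hdens
  · -- `htop`: the top cell — W = 0: the δ = 0 corner ((γ), LH4-p15 `diagCell_gapZero_identity` over (α) LH4-p12 + (δ) this seat); W ≥ 1: ★ A5 `topCell_identity` (LH4-p15)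
    rcases Nat.eq_zero_or_pos ((jl - m) / 2) with hW0 | hWpos
    · -- W = 0 (δ = 0, `jl = m`, the lone DIAGONAL cell): ★ (2b) `diagCell_gapZero_identity_of_row` (LH4-p11 (g12)) = ★ (δ) p865093 gap-zero chart (this seat) + top digits +
      -- ★ (γ-2) p865211 the two gap-zero cell laws (LH4-p15 over ★ (α) p865150 `rowDiag_cellDiff_mul_card_eq_gapZero`, LH4-p12) + ★ A5-SIZES p865144 at `N := 0` + ★ (γ) p865076
      have hjlm : jl = m := by omega
      rw [hW0, Nat.mul_zero, Nat.add_zero]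
      exact diagCell_gapZero_identity_of_row σ ϖ d tE hD hσσ jE ρ Θ α lam hρρ hvρ hjv hjfix hΘj hΘΘ hΘρ hvΘ hα hα1 hint hΘlam hvlam hU hτ hσres hDM hjiso hq hjpow hϖmax u m
        jl hm hjl hum h2 γ₂ hΓ φ h hφs hφi hφo hφγ hform hΘh hh hhyper f hfinLS hf P₁ dg η γ₁ hA hΓ' hdg1 hdgσ hησ hη1 hηN φ' h' hφ's hφ'i hφ'o hφ'γ hform' hΘh' hh' han
        f' hfinLS' hf' hfloor.1 hNm hu1N hlam1 b (by omega) hjlm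
    -- W ≥ 1: ★ (2a) p865192 `topCell_identity_of_row` (LH4-p18 (g5)) = ★ A1-top p865011 + top digits + ★ A5-SIZES p865144 + ★ A5 p865015 `topCell_identity`
    exact topCell_identity_of_row σ ϖ d tE hD jE ρ Θ α lam hρρ hvρ hjv hjfix hΘj hΘΘ hΘρ hvΘ hα hα1 hint hΘlam hvlam hU hτ hσres hDM hjiso hq hjpow hϖmax u m jl hm
      hjl hum h2 γ₂ hΓ φ h hφs hφi hφo hφγ hform hΘh hh hhyper f hfinLS hf P₁ dg η γ₁ hA hΓ' hdg1 hdgσ hησ hη1 hηN φ' h' hφ's hφ'i hφ'o hφ'γ hform' hΘh' hh' han f'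
      hfinLS' hf' hfloor.1 hNm hu1N hlam1 b hb (by omega) hWpos hWjl

end Summit.HodgeConjecture.HodgeConjecture.Cruxes.H413.F0P3cDyRamCoreOddHolds

end
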